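import Summits.ResolutionOfSingularities.ResolutionOfSingularities.Theorems.FrobeniusLadderFRationalResolutionBlowupCartierBaseChange
import Literature.AlgebraicGeometry.Resolution.AffineBlowupUnique
import Mathlib.AlgebraicGeometry.PullbackCarrier
import Mathlib.RingTheory.Localization.AtPrime.Basic
import HarnessLib

/-!
# Crux `FrobeniusLadder.FRationalResolution` (stmt-ResolutionOfSingularities-15317), line `redirect`,
# stub `stub_diagonalizableQuotientResolution` — Cartier-ness on an affine blow-up can be checked after a FLAT base change whose
# image CONTAINS `V(L)` (localization at the point; an étale chart covering the point)

`…BlowupCartierBaseChange.isEffectiveCartier_comap_affineBlowup_of_flat_surjective` (✓p835409) asks the flat base change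
`Spec C → Spec B` to be SURJECTIVE. For the Galois route the ideal `L` to be shown Cartier on `Bl_I(Spec B')` is a twist
`(1 ⊗ σ) I₁` of a `𝔔'`-primary piece, so `V(L) = {𝔔'}`: off `V(L)` the pulled-back ideal sheaf is the unit ideal and nothing is to
be checked. Hence surjectivity may be replaced by `V(L) ⊆ im (Spec C → Spec B)`, which holds for (a) the LOCAL RING `B_{𝔔'}`
(reduction of the obligation to one local ring — the first step towards reading it in the henselization/completion, memo
MEMO-15317-leafhand2-g13 §3b) and (b) the étale chart `C'_G` of `…GaloisUpstairsPieceCover` as soon as its image contains `𝔔'`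
(no shrinking of `B'` to `B'_h` needed for the Cartier check).

* `IsEffectiveCartier.of_comap_of_flat_of_support_subset_range` — effective Cartier divisors descend along a flat morphism whose
  image contains the support.
* **`isEffectiveCartier_comap_affineBlowup_of_flat_of_zeroLocus_subset_range`** — `φ : B → C` flat with `V(L) ⊆ im Spec φ`:
  `π'⁻¹(LC)~` Cartier on `Bl_{IC}(Spec C)` ⇒ `π⁻¹L̃` Cartier on `Bl_I(Spec B)`.
* `isEffectiveCartier_comap_affineBlowup_of_atPrime` — case (a): `L ⊇ 𝔮ᵐ`, `𝔮` maximal, base change to `B_𝔮`.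
* `isEffectiveCartier_comap_affineBlowup_of_flat_chart` — case (b): `L ⊇ 𝔮ᵐ`, `𝔮` maximal in the image of a flat `B`-algebra.

Honest label: generic scheme plumbing toward ONE leaf stub (no stub, crux or summit closed). No definitions, no named facts, no
sorry. [cite: GortzWedhorn2020, Prop. 13.91 (2)] [cite: StacksProject, Tag 02OO; Tag 01WS]
-/

noncomputable section

-- single-problem summit: the doubled namespace component is forced
set_option linter.dupNamespace false

open CategoryTheory CategoryTheory.Limits AlgebraicGeometry
open Literature.AlgebraicGeometry.Resolution
open Summit.ResolutionOfSingularities.ResolutionOfSingularities.Theorems.FRationalResolution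

namespace Summit.ResolutionOfSingularities.ResolutionOfSingularities.Theorems.FRationalResolution.BlowupCartierBaseChangeLocal

universe u

/-- **Effective Cartier divisors descend along a flat morphism whose image contains the support** (`X` locally Noetherian):
points off the support lie in the Cartier locus for free. [cite: StacksProject, Tag 02OO; Tag 01WS] -/
theorem IsEffectiveCartier.of_comap_of_flat_of_support_subset_range {X Y : Scheme.{u}} [IsLocallyNoetherian X]
    (f : Y ⟶ X) [Flat f] (K : X.IdealSheafData) (hK : (K.support : Set X) ⊆ Set.range f.base)
    (h : IsEffectiveCartier (K.comap f)) : IsEffectiveCartier K := by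
  rw [isEffectiveCartier_iff_forall_mem_cartierLocus]
  intro x
  by_cases hx : x ∈ (K.support : Set X)
  · obtain ⟨y, rfl⟩ := hK hx
    exact CartierDescentFlat.mem_cartierLocus_of_flat_stalkMap f K y (Flat.stalkMap f y) (h.mem_cartierLocus y)
  · exact mem_cartierLocus_of_not_mem_support K hx

/-- **Cartier-ness on `Bl_I(Spec B)` descends from `Bl_{IC}(Spec C)` for `Spec C → Spec B` flat with image containing `V(L)`.**
[cite: GortzWedhorn2020, Prop. 13.91 (2)] [cite: StacksProject, Tag 02OO; Tag 01WS] -/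
theorem isEffectiveCartier_comap_affineBlowup_of_flat_of_zeroLocus_subset_range {B C : Type u} [CommRing B] [CommRing C]
    [IsNoetherianRing B] (φ : B →+* C) [Flat (Spec.map (CommRingCat.ofHom φ))] (I L : Ideal B)
    (hL : PrimeSpectrum.zeroLocus (L : Set B) ⊆ Set.range (Spec.map (CommRingCat.ofHom φ)).base)
    (h : IsEffectiveCartier ((affineBlowup.idealSheaf (L.map φ)).comap (affineBlowup.π (I.map φ)))) :
    IsEffectiveCartier ((affineBlowup.idealSheaf L).comap (affineBlowup.π I)) := by
  set j := Spec.map (CommRingCat.ofHom φ) with hj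
  haveI : IsLocallyNoetherian (affineBlowup I) := LocallyOfFiniteType.isLocallyNoetherian (affineBlowup.π I)
  -- the base change of `Bl_I(Spec B)` along `j` is a blow-up of `Spec C` along `(IC)~`, hence `≅ Bl_{IC}(Spec C)`
  have hbc : IsBlowup (pullback.snd (affineBlowup.π I) j) (affineBlowup.idealSheaf (I.map φ)) := by
    rw [← BlowupFlatCriteria.idealSheaf_comap_specMap]
    exact (affineBlowup.isBlowup I).pullback_snd_of_flat j
  obtain ⟨e, he, -⟩ := hbc.unique (affineBlowup.isBlowup (I.map φ))
  -- pull the ideal sheaf back to the fibre product through `Bl_{IC}(Spec C)`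
  have hK : (((affineBlowup.idealSheaf L).comap (affineBlowup.π I)).comap (pullback.fst (affineBlowup.π I) j)) =
      (((affineBlowup.idealSheaf (L.map φ)).comap (affineBlowup.π (I.map φ))).comap e.hom) := by
    rw [← Scheme.IdealSheafData.comap_comp, ← Scheme.IdealSheafData.comap_comp, pullback.condition, he,
      Scheme.IdealSheafData.comap_comp, hj, BlowupFlatCriteria.idealSheaf_comap_specMap]
  have hcart : IsEffectiveCartier
      (((affineBlowup.idealSheaf L).comap (affineBlowup.π I)).comap (pullback.fst (affineBlowup.π I) j)) := by
    rw [hK]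
    exact h.comap_iso e
  -- the support of `π⁻¹L̃` is `π⁻¹ V(L)`, inside the image `π⁻¹ (im j)` of the flat projection
  refine IsEffectiveCartier.of_comap_of_flat_of_support_subset_range (pullback.fst (affineBlowup.π I) j) _ ?_ hcart
  rw [Scheme.Pullback.range_fst, Scheme.IdealSheafData.support_comap, TopologicalSpace.Closeds.coe_preimage,
    affineBlowup.support_idealSheaf]
  exact Set.preimage_mono hL

/-- `V(L) = {𝔮}` for `𝔮` maximal and `𝔮ᵐ ⊆ L ≠ ⊤`; more precisely every prime over `L` is `𝔮`. [folklore] -/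
theorem eq_of_pow_le_of_le {B : Type u} [CommRing B] (𝔮 : Ideal B) [h𝔮 : 𝔮.IsMaximal] (L : Ideal B) {m : ℕ}
    (hL : 𝔮 ^ m ≤ L) (𝔭 : Ideal B) [h𝔭 : 𝔭.IsPrime] (h : L ≤ 𝔭) : 𝔭 = 𝔮 :=
  (h𝔮.eq_of_le h𝔭.ne_top (h𝔭.le_of_pow_le (hL.trans h))).symm

/-- **Case (a): reduction to the local ring.** `B` Noetherian, `𝔮` maximal, `𝔮ᵐ ⊆ L`: if `π'⁻¹(L B_𝔮)~` is an effective Cartier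
divisor on `Bl_{I B_𝔮}(Spec B_𝔮)`, then `π⁻¹L̃` is one on `Bl_I(Spec B)`. [cite: GortzWedhorn2020, Prop. 13.91 (2)]
[cite: StacksProject, Tag 02OO] -/
theorem isEffectiveCartier_comap_affineBlowup_of_atPrime {B : Type u} [CommRing B] [IsNoetherianRing B]
    (𝔮 : Ideal B) [h𝔮 : 𝔮.IsMaximal] (I L : Ideal B) {m : ℕ} (hL : 𝔮 ^ m ≤ L)
    (h : IsEffectiveCartier ((affineBlowup.idealSheaf (L.map (algebraMap B (Localization.AtPrime 𝔮)))).comap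
      (affineBlowup.π (I.map (algebraMap B (Localization.AtPrime 𝔮)))))) :
    IsEffectiveCartier ((affineBlowup.idealSheaf L).comap (affineBlowup.π I)) := by
  haveI : Flat (Spec.map (CommRingCat.ofHom (algebraMap B (Localization.AtPrime 𝔮)))) := by
    rw [HasRingHomProperty.Spec_iff (P := @Flat), CommRingCat.hom_ofHom]
    exact RingHom.flat_algebraMap_iff.mpr (IsLocalization.flat _ 𝔮.primeCompl)
  refine isEffectiveCartier_comap_affineBlowup_of_flat_of_zeroLocus_subset_range _ I L ?_ h
  intro 𝔭 h𝔭
  have h𝔭𝔮 : 𝔭.asIdeal = 𝔮 := eq_of_pow_le_of_le 𝔮 L hL 𝔭.asIdeal h𝔭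
  have hmem : 𝔭 ∈ Set.range (PrimeSpectrum.comap (algebraMap B (Localization.AtPrime 𝔮))) := by
    rw [PrimeSpectrum.localization_comap_range (Localization.AtPrime 𝔮) 𝔮.primeCompl]
    change Disjoint ((𝔮.primeCompl : Set B)) (𝔭.asIdeal : Set B)
    rw [h𝔭𝔮]
    exact Set.disjoint_left.mpr fun x hx hx' => hx hx'
  obtain ⟨y, hy⟩ := hmem
  exact ⟨y, hy⟩

/-- **Case (b): an étale/flat chart covering the point.** `B` Noetherian, `𝔮` maximal, `𝔮ᵐ ⊆ L`, `C` a flat `B`-algebra whose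
spectrum has a point over `𝔮`: if `π'⁻¹(L C)~` is an effective Cartier divisor on `Bl_{I C}(Spec C)`, then `π⁻¹L̃` is one on
`Bl_I(Spec B)`. (With `…GaloisUpstairsPieceCover`: `C = C'_G`, the point `𝔚 C'_G` over `𝔔'`, `I₁ C'_G = J C'_G`.)
[cite: GortzWedhorn2020, Prop. 13.91 (2)] [cite: StacksProject, Tag 02OO] -/
theorem isEffectiveCartier_comap_affineBlowup_of_flat_chart {B C : Type u} [CommRing B] [CommRing C] [Algebra B C]
    [IsNoetherianRing B] [Module.Flat B C] (𝔮 : Ideal B) [h𝔮 : 𝔮.IsMaximal] (I L : Ideal B) {m : ℕ} (hL : 𝔮 ^ m ≤ L)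
    (𝔚 : Ideal C) [𝔚.IsPrime] (h𝔚 : 𝔚.comap (algebraMap B C) = 𝔮)
    (h : IsEffectiveCartier ((affineBlowup.idealSheaf (L.map (algebraMap B C))).comap
      (affineBlowup.π (I.map (algebraMap B C))))) :
    IsEffectiveCartier ((affineBlowup.idealSheaf L).comap (affineBlowup.π I)) := by
  haveI : Flat (Spec.map (CommRingCat.ofHom (algebraMap B C))) := by
    rw [HasRingHomProperty.Spec_iff (P := @Flat), CommRingCat.hom_ofHom]
    exact RingHom.flat_algebraMap_iff.mpr inferInstance
  refine isEffectiveCartier_comap_affineBlowup_of_flat_of_zeroLocus_subset_range _ I L ?_ h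
  intro 𝔭 h𝔭
  have h𝔭𝔮 : 𝔭.asIdeal = 𝔮 := eq_of_pow_le_of_le 𝔮 L hL 𝔭.asIdeal h𝔭
  refine ⟨⟨𝔚, inferInstance⟩, ?_⟩
  ext1
  change 𝔚.comap (algebraMap B C) = 𝔭.asIdeal
  rw [h𝔚, h𝔭𝔮]

end Summit.ResolutionOfSingularities.ResolutionOfSingularities.Theorems.FRationalResolution.BlowupCartierBaseChangeLocal

end
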